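import Summits.QuantumFields.BalabanUV.T4Continuum.Support.NE7SliceTangentPartLimit
import HarnessLib

/-!
# NE7SliceLimitWorkingRegion — THE SITEWISE LIMIT OF A SLICE-ITERATION ORBIT INHERITS THE WORKING REGION: for gauges `u j` with the chart `U′^{u_j} = W·e^{X(u_j)}`, `‖X(u_j)‖ ≤ 1∕8`,
# corners `u_j(M•z) = e^{h(u_j) z}`, `‖h(u_j)‖ ≤ 1∕8`, converging sitewise to a unitary `u⋆`, the same four facts hold AT `u⋆` (closed balls + `exp ∘ mlog = id` near `1`), and
# `X(u_j) → X(u⋆)`, `h(u_j) → h(u⋆)` sitewise — the bridge from `NE7DefectIterationCauchy.exists_limit_gauge` to `NE7SliceTangentPartLimit.tangentPart_limit_mem` (F4d-ii ↔ F4d-iii)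

Cell `pub-balaban`, rung (B)+1 sub-cell t4, lineage `b2b-balaban-t4-ne7b-p1`, generation 150 (OWNER of BINDER row NE7b; junction service for the NE crew, ruling R-OWNER-149-1 (2)).
A JUNCTION for row NE7 (node U5): memo ROAD-G101 §10 — F4d-ii instantiates the Cauchy engine (`exists_limit_gauge`: a unitary `(tower)`-periodic `u⋆` with `u_j(x) → u⋆(x)` at every
site), F4d-iii (`NE7SliceTangentPartLimit.tangentPart_limit_mem`, this seat) asks for the working-region facts of `NE7SliceIterationStateFacts` AT `u⋆` («chart at u⋆ by exp_mlog»).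
THIS FILE derives them from the facts along the orbit and sitewise convergence alone: the relative bond variables `A_j(b) = W(b)⁻¹U′^{u_j}(b)` and the corner values `u_j(M•z)` converge
(`NE7SliceTangentPartLimit.norm_gaugeAct_sub_le`), stay in the CLOSED `1∕4`-ball at `1` (`norm_rel_sub_one_le`), so their limits do; on that ball `mlog` is `4∕3`-Lipschitz
(`NE7ExpLogSecondOrder.norm_mlog_sub_mlog_le_four_thirds`), so the logs converge and keep `‖·‖ ≤ 1∕8`; and `exp (mlog A) = A` for `‖A − 1‖ < 1` (`MatrixLog.exp_mlog`) gives the chart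
and corner identities at `u⋆`.
WHAT ([folklore]; 0 def, 0 sorry; every `d`; `W`, `U′` unitary; no periodicity, no class needed).
§1 `tendsto_rel` (`A_j(b) → A⋆(b)`), `norm_rel_lim_sub_one_le` (`‖A⋆(b) − 1‖ ≤ 1∕4`), **`tendsto_repLog`** (`X(u_j)(b) → X(u⋆)(b)`), **`norm_repLog_lim_le`** (`‖X(u⋆)(b)‖ ≤ 1∕8`),
   **`chart_lim`** (`gaugeAct u⋆ U′ = vary W (repLog W U′ u⋆) 1`).
§2 `norm_corner_lim_sub_one_le`, **`tendsto_cornerLog`**, **`norm_cornerLog_lim_le`**, **`corner_lim`** (`u⋆(M•z) = exp (cornerLog L k u⋆ z)`).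
§3 **`workingRegion_of_limit`** (the four facts at `u⋆`, packaged in the binder order of `tangentPart_limit_mem`).
§4 (v2 APPEND) **`tangentPart_limit_mem_of_geometric`** (F4d-iii in ONE call from the shape `NE7SliceIterationOrbit.slice_orbit` delivers: geometric rate `C·ϑ^j`, `Df(u j) ≤ ϑ^j·δ₀`).
HONEST FRAMING (page 1): elementary limits over the tree's chart lemmas BY NAME; nothing of Bałaban's asserted; NOT F4d-ii (the engine instantiation), NOT F4e, NOT (S2), NOT NE7, nothing of
row NE7b; spine 0∕9; finite T⁴ rung (B)+1 — NOT infinite volume, NOT mass gap, NOT BetaPertH, NOT Clay.  Continuum YM on T⁴ ⇐ BetaPertH ∧ nine spine estimates (0/9 proved); BetaPertH ⇐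
(D1) ∧ (D4) ∧ CAP+tail; G-an2-4 gates asym, D1 and NE2/3/4.
-/

set_option autoImplicit false

open scoped BigOperators Matrix.Norms.L2Operator Topology
open NormedSpace Finset Filter

namespace Summit.QuantumFields.BalabanUV.T4Continuum.NE7SliceLimitWorkingRegion

open Literature.MathematicalPhysics.QuantumFieldTheory.Balaban1983to89
open B7Prop1Explicit B7Prop2Explicit MatrixLog
open T4AveragingDeficitWall (IsUnitaryCfg vary)
open BlockAverageLogInteraction (norm_exp_sub_one_le_two_mul)
open NE3EnergyShapes (IsUnitarySite)
open NE7ExpLogSecondOrder (norm_mlog_sub_mlog_le_four_thirds)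
open NE7SliceIterationState (repLog cornerLog)
open NE7SliceTangentPartLimit (norm_gaugeAct_sub_le norm_rel_sub_one_le)

noncomputable section

variable {d : ℕ} {n : Type*} [Fintype n] [DecidableEq n] [Nonempty n]

/-- a sequence in a normed group whose distance to `b` is dominated by a null sequence converges to `b`. [folklore] -/
theorem tendsto_of_norm_sub_le {E : Type*} [SeminormedAddCommGroup E] {f : ℕ → E} {b : E} {g : ℕ → ℝ} (hg : Tendsto g atTop (𝓝 0))
    (h : ∀ j, ‖f j - b‖ ≤ g j) : Tendsto f atTop (𝓝 b) := by
  rw [tendsto_iff_norm_sub_tendsto_zero]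
  exact squeeze_zero (fun j => norm_nonneg _) h hg

/-- a limit of points of the closed `ρ`-ball at `1` lies in it. [folklore] -/
theorem norm_sub_one_le_of_tendsto {E : Type*} [SeminormedRing E] {f : ℕ → E} {b : E} {ρ : ℝ} (hf : Tendsto f atTop (𝓝 b)) (h : ∀ j, ‖f j - 1‖ ≤ ρ) :
    ‖b - 1‖ ≤ ρ :=
  le_of_tendsto' ((hf.sub_const 1).norm) h

omit [Nonempty n] in
/-- **`mlog` PASSES TO THE LIMIT ON THE CLOSED `1∕4`-BALL AT `1`**: `f j → b`, `‖f j − 1‖ ≤ 1∕4` ⟹ `mlog (f j) → mlog b` and `‖mlog b‖ ≤ c` whenever every `‖mlog (f j)‖ ≤ c`. [folklore] -/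
theorem tendsto_mlog_of_tendsto {f : ℕ → Matrix n n ℂ} {b : Matrix n n ℂ} (hf : Tendsto f atTop (𝓝 b)) (h : ∀ j, ‖f j - 1‖ ≤ 1 / 4) :
    Tendsto (fun j => mlog (f j)) atTop (𝓝 (mlog b)) := by
  have hb : ‖b - 1‖ ≤ 1 / 4 := norm_sub_one_le_of_tendsto hf h
  have hn : Tendsto (fun j => 4 / 3 * ‖f j - b‖) atTop (𝓝 0) := by
    have := ((tendsto_iff_norm_sub_tendsto_zero.mp hf).const_mul (4 / 3 : ℝ))
    simpa using this
  exact tendsto_of_norm_sub_le hn fun j => norm_mlog_sub_mlog_le_four_thirds (le_refl (1 / 4 : ℝ)) (h j) hb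

omit [Nonempty n] in
/-- … and a uniform bound `‖mlog (f j)‖ ≤ c` passes to the limit. [folklore] -/
theorem norm_mlog_le_of_tendsto {f : ℕ → Matrix n n ℂ} {b : Matrix n n ℂ} (hf : Tendsto f atTop (𝓝 b)) (h : ∀ j, ‖f j - 1‖ ≤ 1 / 4) {c : ℝ}
    (hc : ∀ j, ‖mlog (f j)‖ ≤ c) : ‖mlog b‖ ≤ c :=
  le_of_tendsto' (tendsto_mlog_of_tendsto hf h).norm hc

/-! ## §1 The relative bond variables and the chart at the limit -/

section Chart

variable {W U' : Site d → Fin d → (Matrix n n ℂ)ˣ} (hWu : IsUnitaryCfg W) (hU'u : IsUnitaryCfg U')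
  {u : ℕ → Site d → (Matrix n n ℂ)ˣ} {ulim : Site d → (Matrix n n ℂ)ˣ}
  (hu : ∀ j, IsUnitarySite (u j)) (hl : IsUnitarySite ulim)
  (hconv : ∀ y, Tendsto (fun j => (((u j) y : (Matrix n n ℂ)ˣ) : Matrix n n ℂ)) atTop (𝓝 ((ulim y : (Matrix n n ℂ)ˣ) : Matrix n n ℂ)))
  (hgu : ∀ j, gaugeAct (u j) U' = vary W (repLog W U' (u j)) 1) (hXu : ∀ j y κ, ‖repLog W U' (u j) y κ‖ ≤ 1 / 8)

include hWu hU'u hu hl hconv in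
/-- **THE RELATIVE BOND VARIABLES CONVERGE**: `W(b)⁻¹U′^{u_j}(b) → W(b)⁻¹U′^{u⋆}(b)`. [folklore] -/
theorem tendsto_rel (y : Site d) (κ : Fin d) :
    Tendsto (fun j => (((W y κ)⁻¹ : (Matrix n n ℂ)ˣ) : Matrix n n ℂ) * ((gaugeAct (u j) U' y κ : (Matrix n n ℂ)ˣ) : Matrix n n ℂ)) atTop
      (𝓝 ((((W y κ)⁻¹ : (Matrix n n ℂ)ˣ) : Matrix n n ℂ) * ((gaugeAct ulim U' y κ : (Matrix n n ℂ)ˣ) : Matrix n n ℂ))) := by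
  have hWinv : ((((W y κ)⁻¹ : (Matrix n n ℂ)ˣ)) : Matrix n n ℂ) ∈ unitary (Matrix n n ℂ) := mem_unitaryUnits.mp ((unitaryUnits _).inv_mem (hWu y κ))
  have h0 : Tendsto (fun j => ‖(((u j) y : (Matrix n n ℂ)ˣ) : Matrix n n ℂ) - (ulim y : (Matrix n n ℂ)ˣ)‖
      + ‖(((u j) (y + e κ) : (Matrix n n ℂ)ˣ) : Matrix n n ℂ) - (ulim (y + e κ) : (Matrix n n ℂ)ˣ)‖) atTop (𝓝 0) := by
    have h1 := tendsto_iff_norm_sub_tendsto_zero.mp (hconv y)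
    have h2 := tendsto_iff_norm_sub_tendsto_zero.mp (hconv (y + e κ))
    simpa using h1.add h2
  refine tendsto_of_norm_sub_le h0 fun j => ?_
  rw [← mul_sub, CStarRing.norm_mem_unitary_mul _ hWinv]
  exact norm_gaugeAct_sub_le (hu j) hl hU'u y κ

include hWu hU'u hu hl hconv hgu hXu in
/-- `‖W(b)⁻¹U′^{u⋆}(b) − 1‖ ≤ 1∕4`. [folklore] -/
theorem norm_rel_lim_sub_one_le (y : Site d) (κ : Fin d) :
    ‖(((W y κ)⁻¹ : (Matrix n n ℂ)ˣ) : Matrix n n ℂ) * ((gaugeAct ulim U' y κ : (Matrix n n ℂ)ˣ) : Matrix n n ℂ) - 1‖ ≤ 1 / 4 :=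
  norm_sub_one_le_of_tendsto (tendsto_rel hWu hU'u hu hl hconv y κ) fun j => norm_rel_sub_one_le (hgu j) (hXu j) y κ

include hWu hU'u hu hl hconv hgu hXu in
/-- **`X(u_j)(b) → X(u⋆)(b)`** sitewise. [folklore] -/
theorem tendsto_repLog (y : Site d) (κ : Fin d) :
    Tendsto (fun j => repLog W U' (u j) y κ) atTop (𝓝 (repLog W U' ulim y κ)) :=
  tendsto_mlog_of_tendsto (tendsto_rel hWu hU'u hu hl hconv y κ) fun j => norm_rel_sub_one_le (hgu j) (hXu j) y κ

include hWu hU'u hu hl hconv hgu hXu in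
/-- **`‖X(u⋆)(b)‖ ≤ 1∕8`**. [folklore] -/
theorem norm_repLog_lim_le (y : Site d) (κ : Fin d) : ‖repLog W U' ulim y κ‖ ≤ 1 / 8 :=
  norm_mlog_le_of_tendsto (tendsto_rel hWu hU'u hu hl hconv y κ) (fun j => norm_rel_sub_one_le (hgu j) (hXu j) y κ) fun j => hXu j y κ

include hWu hU'u hu hl hconv hgu hXu in
/-- **THE CHART AT THE LIMIT**: `gaugeAct u⋆ U′ = vary W (repLog W U′ u⋆) 1` (`exp ∘ mlog = id` on `‖· − 1‖ < 1`). [folklore] -/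
theorem chart_lim : gaugeAct ulim U' = vary W (repLog W U' ulim) 1 := by
  funext y κ
  apply Units.ext
  have hnear : ‖(((W y κ)⁻¹ : (Matrix n n ℂ)ˣ) : Matrix n n ℂ) * ((gaugeAct ulim U' y κ : (Matrix n n ℂ)ˣ) : Matrix n n ℂ) - 1‖ < 1 :=
    (norm_rel_lim_sub_one_le hWu hU'u hu hl hconv hgu hXu y κ).trans_lt (by norm_num)
  have hexp : exp (repLog W U' ulim y κ) = (((W y κ)⁻¹ : (Matrix n n ℂ)ˣ) : Matrix n n ℂ) * ((gaugeAct ulim U' y κ : (Matrix n n ℂ)ˣ) : Matrix n n ℂ) := by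
    unfold repLog; exact exp_mlog hnear
  rw [vary, Units.val_mul, val_expUnit, Complex.ofReal_one, one_smul, hexp, ← mul_assoc, Units.mul_inv, one_mul]

end Chart

/-! ## §2 The corner values and the corner identity at the limit -/

section Corner

variable {L : ℕ} (k : ℕ) {u : ℕ → Site d → (Matrix n n ℂ)ˣ} {ulim : Site d → (Matrix n n ℂ)ˣ}
  (hconv : ∀ y, Tendsto (fun j => (((u j) y : (Matrix n n ℂ)ˣ) : Matrix n n ℂ)) atTop (𝓝 ((ulim y : (Matrix n n ℂ)ˣ) : Matrix n n ℂ)))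
  (hcu : ∀ j z, (((u j) (((L : ℤ) ^ (k + 1)) • z) : (Matrix n n ℂ)ˣ) : Matrix n n ℂ) = exp (cornerLog L k (u j) z)) (hhu : ∀ j z, ‖cornerLog L k (u j) z‖ ≤ 1 / 8)

include hcu hhu in
/-- along the orbit the corner values are within `1∕4` of `1`. [folklore] -/
theorem norm_corner_sub_one_le (j : ℕ) (z : Site d) : ‖(((u j) (((L : ℤ) ^ (k + 1)) • z) : (Matrix n n ℂ)ˣ) : Matrix n n ℂ) - 1‖ ≤ 1 / 4 := by
  rw [hcu j z]; exact (norm_exp_sub_one_le_two_mul (hhu j z) (by norm_num)).1.trans (by norm_num)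

include hconv hcu hhu in
/-- `‖u⋆(M•z) − 1‖ ≤ 1∕4`. [folklore] -/
theorem norm_corner_lim_sub_one_le (z : Site d) : ‖((ulim (((L : ℤ) ^ (k + 1)) • z) : (Matrix n n ℂ)ˣ) : Matrix n n ℂ) - 1‖ ≤ 1 / 4 :=
  norm_sub_one_le_of_tendsto (hconv _) fun j => norm_corner_sub_one_le k hcu hhu j z

include hconv hcu hhu in
/-- **`h(u_j)(z) → h(u⋆)(z)`**. [folklore] -/
theorem tendsto_cornerLog (z : Site d) : Tendsto (fun j => cornerLog L k (u j) z) atTop (𝓝 (cornerLog L k ulim z)) :=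
  tendsto_mlog_of_tendsto (hconv _) fun j => norm_corner_sub_one_le k hcu hhu j z

include hconv hcu hhu in
/-- **`‖h(u⋆)(z)‖ ≤ 1∕8`**. [folklore] -/
theorem norm_cornerLog_lim_le (z : Site d) : ‖cornerLog L k ulim z‖ ≤ 1 / 8 :=
  norm_mlog_le_of_tendsto (hconv _) (fun j => norm_corner_sub_one_le k hcu hhu j z) fun j => hhu j z

include hconv hcu hhu in
/-- **THE CORNER IDENTITY AT THE LIMIT**: `u⋆(M•z) = exp (cornerLog L k u⋆ z)`. [folklore] -/
theorem corner_lim (z : Site d) : ((ulim (((L : ℤ) ^ (k + 1)) • z) : (Matrix n n ℂ)ˣ) : Matrix n n ℂ) = exp (cornerLog L k ulim z) := by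
  unfold cornerLog
  exact (exp_mlog ((norm_corner_lim_sub_one_le k hconv hcu hhu z).trans_lt (by norm_num))).symm

end Corner

/-! ## §3 Packaged: the limit is in the working region -/

/-- **THE SITEWISE LIMIT OF THE ORBIT IS IN THE WORKING REGION** (`W`, `U′` unitary; `u_j` with the chart ∕ corner facts; `u⋆` unitary with `u_j(x) → u⋆(x)` — as
`NE7DefectIterationCauchy.exists_limit_gauge` delivers): the four facts `tangentPart_limit_mem` asks of `u⋆` — chart, `‖X(u⋆)‖ ≤ 1∕8`, corners, `‖h(u⋆)‖ ≤ 1∕8`. [folklore] -/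
theorem workingRegion_of_limit {L : ℕ} (k : ℕ) {W U' : Site d → Fin d → (Matrix n n ℂ)ˣ} (hWu : IsUnitaryCfg W) (hU'u : IsUnitaryCfg U')
    {u : ℕ → Site d → (Matrix n n ℂ)ˣ} {ulim : Site d → (Matrix n n ℂ)ˣ} (hu : ∀ j, IsUnitarySite (u j)) (hl : IsUnitarySite ulim)
    (hconv : ∀ y, Tendsto (fun j => (((u j) y : (Matrix n n ℂ)ˣ) : Matrix n n ℂ)) atTop (𝓝 ((ulim y : (Matrix n n ℂ)ˣ) : Matrix n n ℂ)))
    (hgu : ∀ j, gaugeAct (u j) U' = vary W (repLog W U' (u j)) 1) (hXu : ∀ j y κ, ‖repLog W U' (u j) y κ‖ ≤ 1 / 8)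
    (hcu : ∀ j z, (((u j) (((L : ℤ) ^ (k + 1)) • z) : (Matrix n n ℂ)ˣ) : Matrix n n ℂ) = exp (cornerLog L k (u j) z)) (hhu : ∀ j z, ‖cornerLog L k (u j) z‖ ≤ 1 / 8) :
    gaugeAct ulim U' = vary W (repLog W U' ulim) 1 ∧ (∀ y κ, ‖repLog W U' ulim y κ‖ ≤ 1 / 8) ∧
      (∀ z, ((ulim (((L : ℤ) ^ (k + 1)) • z) : (Matrix n n ℂ)ˣ) : Matrix n n ℂ) = exp (cornerLog L k ulim z)) ∧ (∀ z, ‖cornerLog L k ulim z‖ ≤ 1 / 8) :=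
  ⟨chart_lim hWu hU'u hu hl hconv hgu hXu, norm_repLog_lim_le hWu hU'u hu hl hconv hgu hXu,
    corner_lim k hconv hcu hhu, norm_cornerLog_lim_le k hconv hcu hhu⟩

/-! ## §4 (v2 APPEND) F4d-iii FROM THE ORBIT's GEOMETRIC DATA — one call for the consumer of `NE7SliceIterationOrbit.slice_orbit` -/

section Geometric

open AveragingDeficitMultiLevelPrep (LevelSmall tower)
open T4AveragingDeficitWall (SmallField)
open T4AveragingDeficitWallBoundary (IsPeriodicCfg)
open NE3EnergyShapes (IsPeriodicSite)
open NE3QbarIterCovLiftPrep (cruxC)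
open NE3LinearisedAverageSup (curvSum)
open NE7MeanZeroGaugeSliceW (energyBlockLandauW)
open NE7SliceIterationState (tangentPart sliceDefect sliceDefect_nonneg)
open NE7SliceTangentPartLimit (tangentPart_limit_mem)

variable {L : ℕ} (hL : 2 ≤ L) (k : ℕ) {W : Site d → Fin d → (Matrix n n ℂ)ˣ} {x : ℝ} (hWu : IsUnitaryCfg W) (hx : 0 ≤ x) (hs : LevelSmall d L k x)
  (hWx : SmallField W x) (N : ℕ) [NeZero N] (hθ : cruxC d L * (((L : ℝ) ^ (k + 1)) ^ 2 * x) < 1) (U' : Site d → Fin d → (Matrix n n ℂ)ˣ)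
  (hWP : IsPeriodicCfg W ((tower L N (k + 1) : ℕ) : ℤ)) (hU'u : IsUnitaryCfg U') (hU'P : IsPeriodicCfg U' ((tower L N (k + 1) : ℕ) : ℤ))
  (hε : ((L : ℝ) ^ (k + 1)) ^ 2 * x ≤ 1) (hA : curvSum d L (k + 1) x ≤ 2 / 3 * L)

include hWP hU'u hU'P hε hA in
/-- **F4d-iii FROM GEOMETRIC ORBIT DATA**: the working-region facts for every `u j`, a unitary `(tower)`-periodic SITEWISE limit `u⋆`, a geometric rate `‖u j y − u⋆ y‖ ≤ C·ϑ^j` and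
`Df(u j) ≤ ϑ^j·δ₀` (`0 ≤ ϑ < 1`) — the shape `NE7SliceIterationOrbit.slice_orbit` delivers with `ϑ = 1∕2`, `C = 24dM·δ₀` — give `T(u⋆) ∈ 𝒯_E(W)`: the chart∕corner facts at `u⋆` by
`workingRegion_of_limit`, then `NE7SliceTangentPartLimit.tangentPart_limit_mem`. [folklore] -/
theorem tangentPart_limit_mem_of_geometric (u : ℕ → Site d → (Matrix n n ℂ)ˣ) (ulim : Site d → (Matrix n n ℂ)ˣ)
    (hu : ∀ j, IsUnitarySite (u j)) (huP : ∀ j, IsPeriodicSite (u j) ((tower L N (k + 1) : ℕ) : ℤ))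
    (hgu : ∀ j, gaugeAct (u j) U' = vary W (repLog W U' (u j)) 1) (hXu : ∀ j y κ, ‖repLog W U' (u j) y κ‖ ≤ 1 / 8)
    (hcu : ∀ j z, (((u j) (((L : ℤ) ^ (k + 1)) • z) : (Matrix n n ℂ)ˣ) : Matrix n n ℂ) = exp (cornerLog L k (u j) z)) (hhu : ∀ j z, ‖cornerLog L k (u j) z‖ ≤ 1 / 8)
    (hl : IsUnitarySite ulim) (hlP : IsPeriodicSite ulim ((tower L N (k + 1) : ℕ) : ℤ))
    (hconv : ∀ y, Tendsto (fun j => (((u j) y : (Matrix n n ℂ)ˣ) : Matrix n n ℂ)) atTop (𝓝 ((ulim y : (Matrix n n ℂ)ˣ) : Matrix n n ℂ)))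
    {C ϑ δ₀ : ℝ} (hϑ0 : 0 ≤ ϑ) (hϑ1 : ϑ < 1)
    (hrate : ∀ j y, ‖(((u j) y : (Matrix n n ℂ)ˣ) : Matrix n n ℂ) - (ulim y : (Matrix n n ℂ)ˣ)‖ ≤ C * ϑ ^ j)
    (hDf : ∀ j, sliceDefect hL k hWu hx hs hWx N hθ U' (u j) ≤ ϑ ^ j * δ₀) :
    tangentPart hL k hWu hx hs hWx N hθ U' ulim ∈ energyBlockLandauW (d := d) (n := n) L N (k + 1) W := by
  obtain ⟨hgl, hXl, hcl, hhl⟩ := workingRegion_of_limit k hWu hU'u hu hl hconv hgu hXu hcu hhu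
  have hpow : Tendsto (fun j => ϑ ^ j) atTop (𝓝 0) := tendsto_pow_atTop_nhds_zero_of_lt_one hϑ0 hϑ1
  have hr : Tendsto (fun j => C * ϑ ^ j) atTop (𝓝 0) := by simpa using hpow.const_mul C
  have hDf0 : Tendsto (fun j => sliceDefect hL k hWu hx hs hWx N hθ U' (u j)) atTop (𝓝 0) := by
    have hup : Tendsto (fun j => ϑ ^ j * δ₀) atTop (𝓝 0) := by simpa using hpow.mul_const δ₀
    exact squeeze_zero (fun j => sliceDefect_nonneg hL k hWu hx hs hWx N hθ U' (u j)) hDf hup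
  exact tangentPart_limit_mem hL k hWu hx hs hWx N hθ U' hWP hU'u hU'P hε hA u ulim hu huP hgu hXu hcu hhu hl hlP hgl hXl hcl hhl
    (fun j => C * ϑ ^ j) hrate hr hDf0

end Geometric

end

end Summit.QuantumFields.BalabanUV.T4Continuum.NE7SliceLimitWorkingRegion
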